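import Mathlib
import Summits.NavierStokesRegularity.NavierStokesRegularity.Theorems.EulerZoomLiouvillePowerGaugeEulerLiouvilleSelfSimilarSourceBall
import HarnessLib

/-!
# Rung C1 of the crux `EulerZoomLiouville.PowerGaugeEulerLiouville`: vorticity vanishes near every stagnation point
# whose LINEARISATION is an adapted source with stretching below `1 + γ` (pointwise condition at the node)
# (route №10, item stmt-NavierStokesRegularity-19832; `--supports`)

Helper file (theorems only). Seat ns-typeII-p3 (cell ns-regularity-ideate §B, D-0081).  Sequel to
`…SelfSimilarSourceBall`: there the pinching `μ⟪Gh,h⟫ ≤ ⟪G DW(z)h, h⟫ ≤ Λ'⟪Gh,h⟫` was assumed on a whole `G`-ball;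
here it is assumed only AT the stagnation point `y*` (a condition on the matrix `DW(y*) = γI + DV(y*)`) and
propagated to a small ball by continuity of `DV`:

* `pinching_ball_of_node` — if `μ₀⟪Gh,h⟫ ≤ ⟪G DW(y*)h, h⟫ ≤ Λ₀⟪Gh,h⟫` (`G` symmetric, `⟪Gh,h⟫ ≥ g₀‖h‖²`, `g₀ > 0`),
  then for every `η > 0` there is `r > 0` with `(μ₀−η)⟪Gh,h⟫ ≤ ⟪G DW(z)h,h⟫ ≤ (Λ₀+η)⟪Gh,h⟫` on the `G`-ball of
  radius `r` around `y*`;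
* `curl_eq_zero_near_adaptedSourceNode` — **THE NODE THEOREM**: a stagnation point `y*` of `W = γy + V` whose
  linearisation is `G`-pinched in `(0, 1+γ)` — `0 < μ₀`, `Λ₀ < 1 + γ` — has a `G`-ball around it on which
  `curl V ≡ 0`;
* `curl_eq_zero_near_sourceNode` — Euclidean form: `sym DW(y*)` positive definite with largest eigenvalue `< 1 + γ`
  (i.e. the node is strictly outgoing to first order and the stretching `sym DV(y*) < 1`) ⇒ `curl V ≡ 0` on a ball
  around `y*` — CIV 2026 Prop 3.9's «vanishing to infinite order at the node» upgraded to «identically near the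
  node», without analyticity.

With the idea card's linear-algebra input (every HYPERBOLIC SOURCE of `W` admits an adapted `G` with
`0 < μ₀ ≤ Λ₀ < tr DW = 3γ`, Lyapunov), the node theorem says: in the window `γ < ½` (`3γ < 1+γ`) the vorticity of a
classical self-similar profile vanishes near EVERY hyperbolic source of its similarity flow.

WHAT THIS IS NOT: not NS, not E, not rung C1 — local, classical, conditional on the pinching AT the node.
[folklore; cf. ConstantinIgnatovaVicol2026Putative §3.5 Thm 3.8, Prop 3.9]
-/

noncomputable section

-- flat `Theorems/<Route><Decl>…` files of one crux share the namespace of the crux (tree convention)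
set_option linter.dupNamespace false

open MeasureTheory Set Filter Topology Metric Function InnerProductSpace
open scoped RealInnerProductSpace NNReal ContDiff

namespace Summit.NavierStokesRegularity.NavierStokesRegularity.Theorems.PowerGaugeEulerLiouville.Kelvin

open Literature.Analysis Literature.Analysis.FluidPDE

variable {γ : ℝ} {V : EuclideanSpace ℝ (Fin 3) → EuclideanSpace ℝ (Fin 3)} {P : EuclideanSpace ℝ (Fin 3) → ℝ}

/-! ### From the node to a ball, by continuity of `DV` -/

/-- **Pinching at the node propagates to a small adapted ball.** If `DV` is continuous, `G` satisfies
`⟪Gh,h⟫ ≥ g₀‖h‖²` (`g₀ > 0`) and `μ₀⟪Gh,h⟫ ≤ ⟪G(γh + DV(y*)h), h⟫ ≤ Λ₀⟪Gh,h⟫` for all `h`, then for every `η > 0`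
there is `r > 0` such that `(μ₀ − η)⟪Gh,h⟫ ≤ ⟪G(γh + DV(z)h), h⟫ ≤ (Λ₀ + η)⟪Gh,h⟫` whenever
`⟪G(z − y*), z − y*⟫ < r²`. [folklore] -/
theorem pinching_ball_of_node (hDV : Continuous (fderiv ℝ V)) {ystar : EuclideanSpace ℝ (Fin 3)}
    {G : EuclideanSpace ℝ (Fin 3) →L[ℝ] EuclideanSpace ℝ (Fin 3)} {g₀ : ℝ} (hg₀ : 0 < g₀)
    (hGpos : ∀ h : EuclideanSpace ℝ (Fin 3), g₀ * ‖h‖ ^ 2 ≤ ⟪G h, h⟫) {μ₀ Λ₀ : ℝ}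
    (hnode : ∀ h : EuclideanSpace ℝ (Fin 3), μ₀ * ⟪G h, h⟫ ≤ ⟪G (γ • h + fderiv ℝ V ystar h), h⟫ ∧
      ⟪G (γ • h + fderiv ℝ V ystar h), h⟫ ≤ Λ₀ * ⟪G h, h⟫)
    {η : ℝ} (hη : 0 < η) :
    ∃ r : ℝ, 0 < r ∧ ∀ z : EuclideanSpace ℝ (Fin 3), ⟪G (z - ystar), z - ystar⟫ < r ^ 2 →
      ∀ h : EuclideanSpace ℝ (Fin 3), (μ₀ - η) * ⟪G h, h⟫ ≤ ⟪G (γ • h + fderiv ℝ V z h), h⟫ ∧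
        ⟪G (γ • h + fderiv ℝ V z h), h⟫ ≤ (Λ₀ + η) * ⟪G h, h⟫ := by
  -- continuity of `DV` at `y*`: `‖DV z − DV y*‖ ≤ δ'` near `y*`, with `‖G‖ δ' ≤ η g₀`
  have hGn : 0 < ‖G‖ + 1 := by positivity
  set δ' : ℝ := η * g₀ / (‖G‖ + 1) with hδ'
  have hδ'0 : 0 < δ' := by positivity
  obtain ⟨ε, hε, hball⟩ := Metric.continuousAt_iff.1 (hDV.continuousAt (x := ystar)) δ' hδ'0
  -- the `G`-ball of radius `r = ε √g₀` lies in the Euclidean `ε`-ball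
  refine ⟨ε * Real.sqrt g₀, by positivity, fun z hz h => ?_⟩
  have hzE : dist z ystar < ε := by
    rw [dist_eq_norm]
    have h1 : g₀ * ‖z - ystar‖ ^ 2 < (ε * Real.sqrt g₀) ^ 2 := (hGpos _).trans_lt hz
    rw [mul_pow, Real.sq_sqrt hg₀.le] at h1
    have h2 : ‖z - ystar‖ ^ 2 < ε ^ 2 := by nlinarith
    exact lt_of_pow_lt_pow_left₀ 2 hε.le h2
  have hDz : ‖fderiv ℝ V z - fderiv ℝ V ystar‖ < δ' := by rw [← dist_eq_norm]; exact hball hzE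
  -- the perturbation `|⟪G (DV z − DV y*) h, h⟫| ≤ ‖G‖ δ' ‖h‖² ≤ η ⟪G h, h⟫`
  have hpert : |⟪G ((fderiv ℝ V z - fderiv ℝ V ystar) h), h⟫| ≤ η * ⟪G h, h⟫ := by
    calc |⟪G ((fderiv ℝ V z - fderiv ℝ V ystar) h), h⟫| ≤ ‖G ((fderiv ℝ V z - fderiv ℝ V ystar) h)‖ * ‖h‖ :=
          abs_real_inner_le_norm _ _
      _ ≤ ‖G‖ * (‖fderiv ℝ V z - fderiv ℝ V ystar‖ * ‖h‖) * ‖h‖ := by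
          gcongr
          exact (G.le_opNorm _).trans (mul_le_mul_of_nonneg_left (ContinuousLinearMap.le_opNorm _ _) (norm_nonneg _))
      _ ≤ ‖G‖ * (δ' * ‖h‖) * ‖h‖ := by gcongr
      _ = ‖G‖ * δ' * ‖h‖ ^ 2 := by ring
      _ ≤ η * g₀ * ‖h‖ ^ 2 := by
          apply mul_le_mul_of_nonneg_right _ (sq_nonneg _)
          rw [hδ']
          rw [mul_div_assoc']
          rw [div_le_iff₀ hGn]
          nlinarith [norm_nonneg G, hη, hg₀]
      _ ≤ η * ⟪G h, h⟫ := by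
          rw [mul_assoc]
          exact mul_le_mul_of_nonneg_left (hGpos h) hη.le
  have e : ⟪G (γ • h + fderiv ℝ V z h), h⟫ =
      ⟪G (γ • h + fderiv ℝ V ystar h), h⟫ + ⟪G ((fderiv ℝ V z - fderiv ℝ V ystar) h), h⟫ := by
    rw [_root_.sub_apply, ← inner_add_left, ← map_add]
    congr 2
    abel
  obtain ⟨h1, h2⟩ := hnode h
  have h3 := (abs_le.1 hpert).1
  have h4 := (abs_le.1 hpert).2
  rw [e]
  constructor <;> nlinarith

/-! ### The node theorem -/

/-- **VORTICITY VANISHES NEAR EVERY ADAPTED SOURCE NODE.**  Let `(V, P)` be a classical self-similar profile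
(`V` smooth, `‖DV‖ ≤ K`) and `y*` a zero of `W = γy + V` whose linearisation is pinched in an adapted inner product:
`G` symmetric with `⟪Gh,h⟫ ≥ g₀‖h‖²` and `μ₀⟪Gh,h⟫ ≤ ⟪G DW(y*)h, h⟫ ≤ Λ₀⟪Gh,h⟫`, `0 < μ₀`, `Λ₀ < 1 + γ`.  Then there
is `r > 0` with `curl V ≡ 0` on the `G`-ball `{⟪G(y − y*), y − y*⟫ < r²}` (a neighbourhood of `y*`).
[cite: ConstantinIgnatovaVicol2026Putative, §3.5 Thm 3.8 and Prop 3.9 (strengthened: spectral-type condition,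
identically near the node)] -/
theorem curl_eq_zero_near_adaptedSourceNode (hV : ContDiff ℝ ∞ V) {K : ℝ} (hK : ∀ y, ‖fderiv ℝ V y‖ ≤ K)
    (hprof : IsSelfSimilarEulerProfile γ 0 V P)
    {ystar : EuclideanSpace ℝ (Fin 3)} (hstar : selfSimilarTransport γ 0 V ystar = 0)
    {G : EuclideanSpace ℝ (Fin 3) →L[ℝ] EuclideanSpace ℝ (Fin 3)}
    (hGsym : ∀ u v : EuclideanSpace ℝ (Fin 3), ⟪G u, v⟫ = ⟪u, G v⟫) {g₀ : ℝ} (hg₀ : 0 < g₀)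
    (hGpos : ∀ h : EuclideanSpace ℝ (Fin 3), g₀ * ‖h‖ ^ 2 ≤ ⟪G h, h⟫)
    {μ₀ Λ₀ : ℝ} (hμ₀ : 0 < μ₀) (hΛ₀ : Λ₀ < 1 + γ)
    (hnode : ∀ h : EuclideanSpace ℝ (Fin 3), μ₀ * ⟪G h, h⟫ ≤ ⟪G (γ • h + fderiv ℝ V ystar h), h⟫ ∧
      ⟪G (γ • h + fderiv ℝ V ystar h), h⟫ ≤ Λ₀ * ⟪G h, h⟫) :
    ∃ r : ℝ, 0 < r ∧ ∀ y : EuclideanSpace ℝ (Fin 3), ⟪G (y - ystar), y - ystar⟫ < r ^ 2 → curl V y = 0 := by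
  have hDV : Continuous (fderiv ℝ V) := hV.continuous_fderiv (by simp)
  -- `η = min(μ₀/2, (1+γ−Λ₀)/2)`
  set η : ℝ := min (μ₀ / 2) ((1 + γ - Λ₀) / 2) with hη
  have hη0 : 0 < η := lt_min (by linarith) (by linarith)
  have hη1 : η ≤ μ₀ / 2 := min_le_left _ _
  have hη2 : η ≤ (1 + γ - Λ₀) / 2 := min_le_right _ _
  obtain ⟨r, hr, hpinch⟩ := pinching_ball_of_node (γ := γ) hDV hg₀ hGpos hnode hη0
  refine ⟨r, hr, curl_eq_zero_on_adaptedSourceBall hV hK hprof hstar hGsym hg₀ hGpos (μ := μ₀ - η)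
    (Λ' := Λ₀ + η) (by linarith) (by linarith) hpinch⟩

/-- **Euclidean form.**  If `y*` is a zero of `W = γy + V` at which the symmetric part of `DW(y*)` is pinched,
`μ₀‖h‖² ≤ ⟪γh + DV(y*)h, h⟫ ≤ Λ₀‖h‖²` with `0 < μ₀` and `Λ₀ < 1 + γ` (first-order strict outgoing node with
stretching `sym DV(y*) ≤ Λ₀ − γ < 1`), then `curl V ≡ 0` on a Euclidean ball around `y*`.
[cite: ConstantinIgnatovaVicol2026Putative, §3.5 Prop 3.9 (strengthened conclusion)] -/
theorem curl_eq_zero_near_sourceNode (hV : ContDiff ℝ ∞ V) {K : ℝ} (hK : ∀ y, ‖fderiv ℝ V y‖ ≤ K)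
    (hprof : IsSelfSimilarEulerProfile γ 0 V P)
    {ystar : EuclideanSpace ℝ (Fin 3)} (hstar : selfSimilarTransport γ 0 V ystar = 0)
    {μ₀ Λ₀ : ℝ} (hμ₀ : 0 < μ₀) (hΛ₀ : Λ₀ < 1 + γ)
    (hnode : ∀ h : EuclideanSpace ℝ (Fin 3), μ₀ * ‖h‖ ^ 2 ≤ ⟪γ • h + fderiv ℝ V ystar h, h⟫ ∧
      ⟪γ • h + fderiv ℝ V ystar h, h⟫ ≤ Λ₀ * ‖h‖ ^ 2) :
    ∃ r : ℝ, 0 < r ∧ ∀ y : EuclideanSpace ℝ (Fin 3), ‖y - ystar‖ < r → curl V y = 0 := by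
  have hGsym : ∀ u v : EuclideanSpace ℝ (Fin 3),
      ⟪ContinuousLinearMap.id ℝ (EuclideanSpace ℝ (Fin 3)) u, v⟫ = ⟪u, ContinuousLinearMap.id ℝ _ v⟫ :=
    fun u v => rfl
  have hGpos : ∀ h : EuclideanSpace ℝ (Fin 3),
      (1 : ℝ) * ‖h‖ ^ 2 ≤ ⟪ContinuousLinearMap.id ℝ (EuclideanSpace ℝ (Fin 3)) h, h⟫ := fun h => by
    rw [ContinuousLinearMap.id_apply, real_inner_self_eq_norm_sq, one_mul]
  have hnode' : ∀ h : EuclideanSpace ℝ (Fin 3),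
      μ₀ * ⟪ContinuousLinearMap.id ℝ (EuclideanSpace ℝ (Fin 3)) h, h⟫ ≤
          ⟪ContinuousLinearMap.id ℝ (EuclideanSpace ℝ (Fin 3)) (γ • h + fderiv ℝ V ystar h), h⟫ ∧
        ⟪ContinuousLinearMap.id ℝ (EuclideanSpace ℝ (Fin 3)) (γ • h + fderiv ℝ V ystar h), h⟫ ≤
          Λ₀ * ⟪ContinuousLinearMap.id ℝ (EuclideanSpace ℝ (Fin 3)) h, h⟫ := fun h => by
    simp only [ContinuousLinearMap.id_apply, real_inner_self_eq_norm_sq]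
    exact hnode h
  obtain ⟨r, hr, hzero⟩ := curl_eq_zero_near_adaptedSourceNode hV hK hprof hstar hGsym one_pos hGpos hμ₀ hΛ₀
    hnode'
  refine ⟨r, hr, fun y hy => hzero y ?_⟩
  rw [ContinuousLinearMap.id_apply, real_inner_self_eq_norm_sq]
  exact pow_lt_pow_left₀ hy (norm_nonneg _) two_ne_zero

end Summit.NavierStokesRegularity.NavierStokesRegularity.Theorems.PowerGaugeEulerLiouville.Kelvin

end
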